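import Summits.QuantumFields.YangMills.Theorems.LuscherReductionTwistedTraceScalingBOStiffAlmostOrth
import Summits.QuantumFields.YangMills.Theorems.LuscherReductionTwistedTraceScalingBOStiffFibreTail
import Summits.QuantumFields.YangMills.Theorems.LuscherReductionTwistedTraceScalingBOStiffTailsRecord
import HarnessLib

/-!
# (B-ST) step (B)/(L-4), THE FIBREWISE GROUND COEFFICIENT OF THE CORE PIECE OF RECORD: `(∫_x v₁(oT u x)·Θ(x)·w̄(x) dπ)² ≤ a·γ(β)·∫_x v(oT u x)²·w_u(x) dπ`, any `a > 0`, every `u`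
# (lane A of S-BASE, crux `TwistedTraceScaling` stmt-QuantumFields-20203, C4-CORE, the (B-ST) pen; HANDOFF-g21 UPDATE 19:05Z (W1-3) / STUB LEDGER (L-4))

In the lead's assembly (`…BOStiffSlowAssembly.form_le_of_product_near` applied to the CORE piece `v₁ = 𝟙_{(S₂∪S₃)ᶜ}·v` on the orthographic tube, reference fibre weight
`w̄(x) = softWeight χ (orthoTube 1 x)`, profile `Θ(x) = Ω_c(linkEmbed x)`) the ground term is `C = ∫_u (∫_x v₁(oT u x)Θ(x)w̄(x) dπ)²/Z̄ dσ`.  The hypothesis of `hST` is exact orthogonality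
in the TRUE weight `w_u(x) = softWeight χ (orthoTube u x)`: `fibreInner L (softWeight χ) Ω_c v u = 0` for every `u`.  This file bounds the numerator u-POINTWISE, for every slow `u`:
★★★ `core_coeff_sq_le_mul_recordGamma` — for `L ≥ 2` with a non-zero site, `0 < s ≤ 1/3`: `∃ M₀ ≥ 2, ∀ M ≥ M₀, ∀ a > 0, ∀ᶠ β, ∀ u, ∀ v` (measurable, bounded, supported in
`{recordChi L s 43 M β ≠ 0}`, `fibreInner … v u = 0`):
  `(∫_x (𝟙_{(S₂(β)∪S₃(β))ᶜ} v)(orthoTube u x)·Ω_c(x̂)·softWeight χ (orthoTube 1 x) dπ)² ≤ a·γ(β)·∫_x v(orthoTube u x)²·softWeight χ (orthoTube u x) dπ`,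
with the cut sets of record `S₂(β) = {β^{-1}ℓ < ‖P_Γ relLinkVec‖}`, `S₃(β) = {r_f/2 < ‖relLinkVec‖}` of `…BOStiffTailsRecord` and `γ = recordGamma L Ω_c β` (the same
with `γ` replaced by the lead's normalisation `Z̄ = fibreMass L (softWeight χ) Ω_c 1 = ∫ Θ²w̄ dπ ≥ (1 − C_Pδ²)γ` is `…BOStiffCoreCoeffMass.core_coeff_sq_le_mul_fibreMass_one`).
Integrating over `u` (`∫_u ∫_x v(oT u x)² w_u dπ dσ = ‖v‖²_w` on the tube) gives `C ≤ a·‖v‖²_w`, the (L-4) input, for any `a > 0`.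
Ingredients: `…BOStiffAlmostOrth.sq_integral_core_profile_le'` (Cauchy–Schwarz twice) with `S' = S_x ∩ {Θ ≠ 0}`, `S_x = {‖x̂‖ ≤ r_f/2} ∩ {‖P_Γx̂‖ ≤ β^{-1}ℓ}` (at tube points
`relLinkVec (orthoTube u x) = x̂`); the ν-tail `…BOStiffFibreTail.eventually_fibre_tail_le_mul_recordGamma`; the WEIGHT COMPARISON ★ `softWeight_orthoTube_compare`
(`|w̄(x) − w_u(x)| ≤ (2C_Pδ²/(1−C_Pδ²))·w_u(x)` when both tube points lie in the fat tube: the Gaussian factor of `χ` is the same at `orthoTube u x` and `orthoTube 1 x`, and (P)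
`…FPWeightCore.fpWeight_core_constant` prices both `N`'s), the profile-support geometry `…BOSupportGeometry.orthoTube_mem_fatTubeRho` at `u = 1` (eventually `4r_f|E| < 43β^{-s}`), and
★ `fibre_sq_mass_le` (`∫ Θ²w_u dπ ≤ (1 + C_Pδ²)·γ` for EVERY `u`: `…BOStiffFibreTail.recordProfile_sq_mul_softWeight_eq` + (P) from above + `recordGamma_eq`).
HONEST FRAMING: bookkeeping for a stub of a child of the CONDITIONAL route R2b1; (B-ST) OPEN; C4-CORE OPEN; not infinite volume, not a gap, not Clay.
-/

set_option autoImplicit false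

noncomputable section

open MeasureTheory Filter Topology Real
open scoped BigOperators
open Literature.MathematicalPhysics.QuantumFieldTheory
open Literature.MathematicalPhysics.QuantumLattice

namespace Summit.QuantumFields.YangMills.Theorems.FemtoTransferGap.TwoLattice.ConstTube

open Summit.QuantumFields.YangMills.Theorems.FemtoTransferGap
open Summit.QuantumFields.YangMills.Theorems.FemtoTransferGap.TwoLattice
open Summit.QuantumFields.YangMills.Theorems.FemtoTransferGap.TwoLattice.Avg
open Summit.QuantumFields.YangMills.Theorems.FemtoTransferGap.TwoLattice.Stiff
open Summit.QuantumFields.YangMills.Theorems.FemtoTransferGap.TwoLattice.GnChart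
open Summit.QuantumFields.YangMills.Theorems.FemtoTransferGap.TwoLattice.Cov
open Summit.QuantumFields.YangMills.Theorems.FemtoTransferGap.TwoLattice.Toron

variable {L : ℕ} [NeZero L]

/-! ## §1 The weight comparison and the fibre mass from above -/

/-- ★ **WEIGHT COMPARISON ACROSS THE SLOW VARIABLE**: for `x` in the cap with `orthoTube u x` and `orthoTube 1 x` both in the fat tube `F` of `χ = recordChi L s K M β`, and (P)
`N̄(1−κ) ≤ gaugeAvg χ ≤ N̄(1+κ)` on `F` (`0 ≤ κ < 1`): `|softWeight χ (orthoTube 1 x) − softWeight χ (orthoTube u x)| ≤ (2κ/(1−κ))·softWeight χ (orthoTube u x)` — the Gaussian factor of `χ`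
depends on the fibre coordinate only. [cite: Luscher1983, §3] -/
theorem softWeight_orthoTube_compare (s K M β : ℝ) {Nbar κ : ℝ} (hκ0 : 0 ≤ κ) (hκ : κ < 1)
    (hP : ∀ U ∈ fatTubeRho L (fun β => K * powScale s β) (fun b => M * (K * powScale s b)) β,
      Nbar * (1 - κ) ≤ gaugeAvg (recordChi L s K M β) U ∧ gaugeAvg (recordChi L s K M β) U ≤ Nbar * (1 + κ))
    (u : GaugeConfig 3 1 SU2) {x : Edge 3 L → Fin 3 → ℝ} (hx : x ∈ capBalancedSet L)
    (hU : orthoTube L u x ∈ fatTubeRho L (fun β => K * powScale s β) (fun b => M * (K * powScale s b)) β)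
    (hU₁ : orthoTube L 1 x ∈ fatTubeRho L (fun β => K * powScale s β) (fun b => M * (K * powScale s b)) β) :
    |softWeight (recordChi L s K M β) (orthoTube L 1 x) - softWeight (recordChi L s K M β) (orthoTube L u x)| ≤
      2 * κ / (1 - κ) * softWeight (recordChi L s K M β) (orthoTube L u x) := by
  set c : ℝ := Real.exp (-(‖(gaugeModes L).starProjection (linkEmbed L x)‖ ^ 2 / powScale 1 β ^ 2)) with hcdef
  have hc : 0 < c := Real.exp_pos _
  have hχu : recordChi L s K M β (orthoTube L u x) = c := by
    rw [recordChi_eq_indicator_mul, Set.indicator_of_mem hU, one_mul, gaugeCoordSq_orthoTube u hx]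
  have hχ1 : recordChi L s K M β (orthoTube L 1 x) = c := by
    rw [recordChi_eq_indicator_mul, Set.indicator_of_mem hU₁, one_mul, gaugeCoordSq_orthoTube 1 hx]
  rw [softWeight_eq_div, softWeight_eq_div, hχu, hχ1]
  obtain ⟨hlo, -⟩ := hP _ hU
  obtain ⟨-, hhi1⟩ := hP _ hU₁
  obtain ⟨hlo1, -⟩ := hP _ hU₁
  obtain ⟨-, hhiu⟩ := hP _ hU
  have h1κ : 0 < 1 - κ := by linarith
  -- `|N₁ − N_u| ≤ 2κN̄ ≤ (2κ/(1−κ))·N_u`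
  have hdiff : |gaugeAvg (recordChi L s K M β) (orthoTube L 1 x) - gaugeAvg (recordChi L s K M β) (orthoTube L u x)| ≤ 2 * κ * Nbar := by
    rw [abs_le]; constructor <;> nlinarith
  have hNu : Nbar ≤ gaugeAvg (recordChi L s K M β) (orthoTube L u x) / (1 - κ) := by rw [le_div_iff₀ h1κ]; exact hlo
  rw [← sub_div, abs_div, abs_of_pos hc, div_le_iff₀ hc]
  calc |gaugeAvg (recordChi L s K M β) (orthoTube L 1 x) - gaugeAvg (recordChi L s K M β) (orthoTube L u x)| ≤ 2 * κ * Nbar := hdiff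
    _ ≤ 2 * κ * (gaugeAvg (recordChi L s K M β) (orthoTube L u x) / (1 - κ)) := mul_le_mul_of_nonneg_left hNu (by positivity)
    _ = 2 * κ / (1 - κ) * (gaugeAvg (recordChi L s K M β) (orthoTube L u x) / c) * c := by field_simp

/-- ★ **THE FIBRE MASS FROM ABOVE, FOR EVERY slow `u`**: with (P)'s upper bound `gaugeAvg χ ≤ N̄(β^{-1})(1+κ)` on the fat tube,
`∫ Ω_c(x̂)²·softWeight χ (orthoTube u x) dπ ≤ (1+κ)·γ(β)` (`γ = N̄·M₂`, `recordGamma_eq`). [cite: Luscher1983, §3] -/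
theorem fibre_sq_mass_le (s M β : ℝ) {κ : ℝ} (hκ : 0 ≤ κ)
    (hP : ∀ U ∈ fatTubeRho L (fun β => 43 * powScale s β) (fun b => M * (43 * powScale s b)) β,
      gaugeAvg (recordChi L s 43 M β) U ≤ fpWeightBar L (powScale 1 β) * (1 + κ)) (u : GaugeConfig 3 1 SU2) :
    ∫ x, ({x : LinkSpace L | linkCurry x ∈ capBalancedSet L}.indicator (fun _ => (1 : ℝ)) (linkEmbed L x) *
          frozenProfile L (fun β' => stiffGaussExp L (β' / 2) β') (fun β' => min (1 / 40) (powScale (1 / 2) β' * btLog β')) β (linkEmbed L x)) ^ 2 *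
        softWeight (recordChi L s 43 M β) (orthoTube L u x) ∂orthoTransverse L ≤
      (1 + κ) * recordGamma L (fun β' => fun x : LinkSpace L => {x : LinkSpace L | linkCurry x ∈ capBalancedSet L}.indicator (fun _ => (1 : ℝ)) x *
        frozenProfile L (fun β'' => stiffGaussExp L (β'' / 2) β'') (fun β'' => min (1 / 40) (powScale (1 / 2) β'' * btLog β'')) β' x) β := by
  haveI := isFiniteMeasure_orthoTransverse L
  set Nbar := fpWeightBar L (powScale 1 β) with hNbar
  have hNbar0 : 0 < Nbar := fpWeightBar_pos L (powScale_pos 1 β)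
  set F := fatTubeRho L (fun β => 43 * powScale s β) (fun b => M * (43 * powScale s b)) β with hFdef
  set I : (Edge 3 L → Fin 3 → ℝ) → ℝ := fun v =>
    Real.exp (-(stiffGaussExp L (β / 2) β (linkEmbed L v))) ^ 2 * Real.exp (-(‖(gaugeModes L).starProjection (linkEmbed L v)‖ ^ 2 / powScale 1 β ^ 2)) with hIdef
  have hIm : Measurable I := measurable_record_integrand (L := L) β
  have hI01 : ∀ v, 0 ≤ I v ∧ I v ≤ 1 := fun v => by
    refine ⟨by rw [hIdef]; positivity, ?_⟩
    have h1 : Real.exp (-(stiffGaussExp L (β / 2) β (linkEmbed L v))) ^ 2 ≤ 1 :=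
      pow_le_one₀ (Real.exp_pos _).le (Real.exp_le_one_iff.mpr (neg_nonpos.mpr (stiffGaussExp_nonneg _ _ _)))
    have h2 : Real.exp (-(‖(gaugeModes L).starProjection (linkEmbed L v)‖ ^ 2 / powScale 1 β ^ 2)) ≤ 1 :=
      Real.exp_le_one_iff.mpr (neg_nonpos.mpr (by positivity))
    calc I v ≤ 1 * 1 := mul_le_mul h1 h2 (Real.exp_pos _).le zero_le_one
      _ = 1 := one_mul _
  set B : Set (Edge 3 L → Fin 3 → ℝ) := {v | ‖linkEmbed L v‖ ≤ min (1 / 40) (powScale (1 / 2) β * btLog β)} with hBdef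
  have hBm : MeasurableSet B := measurableSet_le (measurable_linkEmbed L).norm measurable_const
  have hb0 : ∀ v, 0 ≤ B.indicator (fun _ => (1 : ℝ)) v := fun v => Set.indicator_nonneg (fun _ _ => zero_le_one) v
  have hb1 : ∀ v, B.indicator (fun _ => (1 : ℝ)) v ≤ 1 := fun v => Set.indicator_le_self' (fun _ _ => zero_le_one) v
  -- pointwise: integrand `≤ 𝟙_B·I·N̄(1+κ)`
  have hpt : ∀ x : Edge 3 L → Fin 3 → ℝ,
      ({x : LinkSpace L | linkCurry x ∈ capBalancedSet L}.indicator (fun _ => (1 : ℝ)) (linkEmbed L x) *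
            frozenProfile L (fun β' => stiffGaussExp L (β' / 2) β') (fun β' => min (1 / 40) (powScale (1 / 2) β' * btLog β')) β (linkEmbed L x)) ^ 2 *
          softWeight (recordChi L s 43 M β) (orthoTube L u x) ≤ (Nbar * (1 + κ)) * (B.indicator (fun _ => (1 : ℝ)) x * I x) := by
    intro x
    by_cases hx : x ∈ capBalancedSet L
    · rw [recordProfile_sq_mul_softWeight_eq s 43 M β u hx]
      have hN : F.indicator (gaugeAvg (recordChi L s 43 M β)) (orthoTube L u x) ≤ Nbar * (1 + κ) := by
        by_cases hU : orthoTube L u x ∈ F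
        · rw [Set.indicator_of_mem hU]; exact hP _ hU
        · rw [Set.indicator_of_notMem hU]; positivity
      have hN0 : 0 ≤ F.indicator (gaugeAvg (recordChi L s 43 M β)) (orthoTube L u x) := by
        by_cases hU : orthoTube L u x ∈ F
        · rw [Set.indicator_of_mem hU]
          obtain ⟨hm, h1, h0, -⟩ := recordChi_props (L := L) s 43 M β
          exact (gaugeAvg_mem_Icc hm (fun V => h0 V) (fun V => (abs_le.mp (h1 V)).2) _).1
        · rw [Set.indicator_of_notMem hU]
      calc B.indicator (fun _ => (1 : ℝ)) x * I x * F.indicator (gaugeAvg (recordChi L s 43 M β)) (orthoTube L u x)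
          ≤ B.indicator (fun _ => (1 : ℝ)) x * I x * (Nbar * (1 + κ)) := mul_le_mul_of_nonneg_left hN (mul_nonneg (hb0 x) (hI01 x).1)
        _ = (Nbar * (1 + κ)) * (B.indicator (fun _ => (1 : ℝ)) x * I x) := by ring
    · have h0 : {x : LinkSpace L | linkCurry x ∈ capBalancedSet L}.indicator (fun _ => (1 : ℝ)) (linkEmbed L x) = 0 :=
        Set.indicator_of_notMem (fun h => hx ((linkEmbed_mem_capLink_iff x).1 h)) _
      rw [h0, zero_mul, zero_pow two_ne_zero, zero_mul]
      exact mul_nonneg (by positivity) (mul_nonneg (hb0 x) (hI01 x).1)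
  have hw0 : ∀ U, 0 ≤ softWeight (recordChi L s 43 M β) U := (softWeight_recordChi_props (L := L) s 43 M β).2.2.1
  have hint : Integrable (fun x => B.indicator (fun _ => (1 : ℝ)) x * I x) (orthoTransverse L) :=
    integrable_of_measurable_abs_le _ ((measurable_const.indicator hBm).mul hIm) (C := 1) fun v => by
      rw [abs_mul, abs_of_nonneg (hb0 v), abs_of_nonneg (hI01 v).1]; exact mul_le_one₀ (hb1 v) (hI01 v).1 (hI01 v).2
  calc _ ≤ ∫ x, (Nbar * (1 + κ)) * (B.indicator (fun _ => (1 : ℝ)) x * I x) ∂orthoTransverse L :=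
        integral_mono_of_nonneg (ae_of_all _ fun x => mul_nonneg (sq_nonneg _) (hw0 _)) (hint.const_mul _) (ae_of_all _ hpt)
    _ = (1 + κ) * (Nbar * ∫ x, B.indicator (fun _ => (1 : ℝ)) x * I x ∂orthoTransverse L) := by rw [integral_const_mul]; ring
    _ = _ := by rw [recordGamma_eq]

/-! ## §2 Eventually: the geometry of the reference fibre and the smallness of the comparison constant -/

/-- The reference fibre lies in the fat tube: eventually in `β`, for `M ≥ 2`, every `x` with `Ω_c(x̂) ≠ 0` (so `‖x̂‖ ≤ r_f`) has `orthoTube 1 x ∈ F`. [folklore] -/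
theorem eventually_orthoTube_one_mem_fatTube {s : ℝ} (hs : 0 < s) (hs2 : s < 1 / 2) {M : ℝ} (hM : 2 ≤ M) :
    ∀ᶠ β : ℝ in atTop, ∀ x : Edge 3 L → Fin 3 → ℝ,
      {x : LinkSpace L | linkCurry x ∈ capBalancedSet L}.indicator (fun _ => (1 : ℝ)) (linkEmbed L x) *
          frozenProfile L (fun β' => stiffGaussExp L (β' / 2) β') (fun β' => min (1 / 40) (powScale (1 / 2) β' * btLog β')) β (linkEmbed L x) ≠ 0 →
        orthoTube L 1 x ∈ fatTubeRho L (fun β => 43 * powScale s β) (fun b => M * (43 * powScale s b)) β := by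
  have ht : Tendsto (fun β : ℝ => powScale (1 / 2 - s) β * btLog β) atTop (𝓝 0) := by
    have h := tendsto_powScale_mul_btLog_pow (p := 1 / 2 - s) (by linarith) 1
    simpa using h
  have hE0 : (0 : ℝ) < Fintype.card (Edge 3 L) := by exact_mod_cast Fintype.card_pos
  have c0 : (0 : ℝ) < 1 / (4 * Fintype.card (Edge 3 L) + 1) := by positivity
  filter_upwards [ht.eventually (gt_mem_nhds c0)] with β hβ x hx
  have hps : 0 < powScale s β := powScale_pos _ _
  have hsplit : powScale (1 / 2) β = powScale (1 / 2 - s) β * powScale s β := by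
    rw [powScale_mul_powScale]; ring_nf
  set t := powScale (1 / 2 - s) β * btLog β with htdef
  have ht0 : 0 ≤ t := mul_nonneg (powScale_pos _ _).le (zero_le_one.trans (one_le_btLog β))
  have hrf : min (1 / 40) (powScale (1 / 2) β * btLog β) ≤ t * powScale s β := by
    rw [hsplit]; refine (min_le_right _ _).trans (le_of_eq (by rw [htdef]; ring))
  have ht1 : t * (4 * Fintype.card (Edge 3 L) + 1) < 1 := by
    have := (lt_div_iff₀ (by positivity : (0 : ℝ) < 4 * Fintype.card (Edge 3 L) + 1)).mp hβ; linarith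
  have hrhalf : min (1 / 40) (powScale (1 / 2) β * btLog β) ≤ 1 / 2 := (min_le_left _ _).trans (by norm_num)
  have hΩR : ∀ y : LinkSpace L, {x : LinkSpace L | linkCurry x ∈ capBalancedSet L}.indicator (fun _ => (1 : ℝ)) y *
      frozenProfile L (fun β' => stiffGaussExp L (β' / 2) β') (fun β' => min (1 / 40) (powScale (1 / 2) β' * btLog β')) β y ≠ 0 →
      ‖y‖ ≤ min (1 / 40) (powScale (1 / 2) β * btLog β) := fun y hy => norm_le_of_frozenProfile_ne_zero _ _ β (right_ne_zero_of_mul hy)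
  have hu : orbitDist (1 : GaugeConfig 3 1 SU2) ≤ 0 := by
    rw [show (1 : GaugeConfig 3 1 SU2) = fun _ => (1 : SU2) from rfl, orbitDist_one]
  refine orthoTube_mem_fatTubeRho (δ' := fun β : ℝ => 43 * powScale s β) (ρ := fun b => M * (43 * powScale s b)) hu hrhalf hΩR ?_ ?_ x hx
  · show 4 * min (1 / 40) (powScale (1 / 2) β * btLog β) + 0 < M * (43 * powScale s β)
    have h1 : 4 * t < 86 := by nlinarith
    nlinarith [mul_le_mul_of_nonneg_right hM (by positivity : (0 : ℝ) ≤ 43 * powScale s β)]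
  · show (Fintype.card (Edge 3 L) : ℝ) * (4 * min (1 / 40) (powScale (1 / 2) β * btLog β) + 0) < 43 * powScale s β
    have h1 : (Fintype.card (Edge 3 L) : ℝ) * (4 * (t * powScale s β)) < 1 * powScale s β := by
      have : 4 * (Fintype.card (Edge 3 L) : ℝ) * t < 1 := by nlinarith
      nlinarith
    nlinarith [mul_le_mul_of_nonneg_left hrf (by positivity : (0 : ℝ) ≤ 4 * (Fintype.card (Edge 3 L) : ℝ))]

set_option maxHeartbeats 1600000 in
-- long record expressions.
/-- ★★★ **THE FIBREWISE GROUND COEFFICIENT OF THE CORE PIECE OF RECORD** (see the module docstring): `∃ M₀ ≥ 2, ∀ M ≥ M₀, ∀ a > 0, ∀ᶠ β, ∀ u, ∀ v` admissible with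
`fibreInner L (softWeight χ) Ω_c v u = 0`:  `(∫_x v₁(oT u x)·Ω_c(x̂)·softWeight χ (oT 1 x) dπ)² ≤ a·γ(β)·∫_x v(oT u x)²·softWeight χ (oT u x) dπ`,
`v₁ = 𝟙_{(S₂(β)∪S₃(β))ᶜ}·v`. [cite: Luscher1983, §3] -/
theorem core_coeff_sq_le_mul_recordGamma (hLz : Nonempty (NzSite L)) (hL : 2 ≤ L) {s : ℝ} (hs : 0 < s) (hs3 : s ≤ 1 / 3) :
    ∃ M₀ : ℝ, 2 ≤ M₀ ∧ ∀ M : ℝ, M₀ ≤ M → ∀ a : ℝ, 0 < a → ∀ᶠ β : ℝ in atTop, ∀ u : GaugeConfig 3 1 SU2,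
      ∀ v : GaugeConfig 3 L SU2 → ℝ, Measurable v → (∃ C : ℝ, ∀ U, |v U| ≤ C) → (∀ U, v U ≠ 0 → recordChi L s 43 M β U ≠ 0) →
        fibreInner L (softWeight (recordChi L s 43 M β)) (fun x : LinkSpace L => {x : LinkSpace L | linkCurry x ∈ capBalancedSet L}.indicator (fun _ => (1 : ℝ)) x *
          frozenProfile L (fun β' => stiffGaussExp L (β' / 2) β') (fun β' => min (1 / 40) (powScale (1 / 2) β' * btLog β')) β x) v u = 0 →
        (∫ x, ({U : GaugeConfig 3 L SU2 | powScale 1 β * btLog β < ‖(gaugeModes L).starProjection (relLinkVec L U)‖} ∪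
                  {U : GaugeConfig 3 L SU2 | min (1 / 40) (powScale (1 / 2) β * btLog β) / 2 < ‖relLinkVec L U‖})ᶜ.indicator v (orthoTube L u x) *
              ({x : LinkSpace L | linkCurry x ∈ capBalancedSet L}.indicator (fun _ => (1 : ℝ)) (linkEmbed L x) *
                frozenProfile L (fun β' => stiffGaussExp L (β' / 2) β') (fun β' => min (1 / 40) (powScale (1 / 2) β' * btLog β')) β (linkEmbed L x)) *
              softWeight (recordChi L s 43 M β) (orthoTube L 1 x) ∂orthoTransverse L) ^ 2 ≤
          a * recordGamma L (fun β' => fun x : LinkSpace L => {x : LinkSpace L | linkCurry x ∈ capBalancedSet L}.indicator (fun _ => (1 : ℝ)) x *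
              frozenProfile L (fun β'' => stiffGaussExp L (β'' / 2) β'') (fun β'' => min (1 / 40) (powScale (1 / 2) β'' * btLog β'')) β' x) β *
            ∫ x, v (orthoTube L u x) ^ 2 * softWeight (recordChi L s 43 M β) (orthoTube L u x) ∂orthoTransverse L := by
  haveI := isFiniteMeasure_orthoTransverse L
  -- (P) for the record weight
  have hδ0 : ∀ β, 0 < 43 * powScale s β := fun β => mul_pos (by norm_num) (powScale_pos s β)
  have hδ : Tendsto (fun β => 43 * powScale s β) atTop (𝓝 0) := by simpa using (tendsto_powScale hs).const_mul 43
  have hsd1 : ∀ᶠ β in atTop, 0 < powScale 1 β ∧ powScale 1 β ≤ (43 * powScale s β) ^ 3 := by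
    filter_upwards [eventually_ge_atTop (1 : ℝ)] with β hβ
    have hp := powScale_pos 1 β
    have h1 : powScale 1 β ≤ powScale s β ^ 3 := powScale_one_le_cube hs3 hβ
    have hps0 : 0 ≤ powScale s β ^ 3 := pow_nonneg (powScale_pos s β).le 3
    refine ⟨hp, h1.trans ?_⟩
    calc powScale s β ^ 3 = 1 * powScale s β ^ 3 := (one_mul _).symm
      _ ≤ 43 ^ 3 * powScale s β ^ 3 := mul_le_mul_of_nonneg_right (by norm_num) hps0
      _ = (43 * powScale s β) ^ 3 := by ring
  obtain ⟨M₁, hM₁, H₁⟩ := fpWeight_core_constant L hLz hδ0 hδ hsd1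
  obtain ⟨M₂, hM₂, H₂⟩ := eventually_fibre_tail_le_mul_recordGamma (L := L) hLz hL hs hs3
  refine ⟨max M₁ M₂, le_max_of_le_left hM₁, fun M hM a ha => ?_⟩
  have hM2 : 2 ≤ M := hM₁.trans ((le_max_left _ _).trans hM)
  obtain ⟨C, β₀, hC, hP⟩ := H₁ M ((le_max_left _ _).trans hM)
  have hδ2 : Tendsto (fun β => (43 * powScale s β) ^ 2) atTop (𝓝 0) := by simpa using hδ.pow 2
  -- smallness of the comparison constant: `η = 2Cδ²/(1−Cδ²) ≤ 4Cδ²`, `2·η²·2 ≤ a/2` eventually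
  have hη : ∀ᶠ β : ℝ in atTop, 2 * ((4 * (C * (43 * powScale s β) ^ 2)) ^ 2 * 2) ≤ a / 2 := by
    have h := ((hδ2.const_mul C).const_mul 4).pow 2 |>.mul_const 2 |>.const_mul 2
    rw [mul_zero, mul_zero, zero_pow two_ne_zero, zero_mul, mul_zero] at h
    exact h.eventually (eventually_le_nhds (by positivity))
  filter_upwards [eventually_ge_atTop β₀, eventually_mul_le_of_tendsto hδ2 C (by norm_num : (0 : ℝ) < 1 / 2), hη,
    H₂ M ((le_max_right _ _).trans hM) (a / 4) (by positivity), eventually_orthoTube_one_mem_fatTube (L := L) hs (by linarith) hM2]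
    with β hβ0 hCδ hηβ htail hgeo u v hv hCb hsupp horth
  obtain ⟨Cv, hCv⟩ := hCb
  -- names
  set χ := recordChi L s 43 M β with hχdef
  set F := fatTubeRho L (fun β => 43 * powScale s β) (fun b => M * (43 * powScale s b)) β with hFdef
  set Ω : LinkSpace L → ℝ := fun x => {x : LinkSpace L | linkCurry x ∈ capBalancedSet L}.indicator (fun _ => (1 : ℝ)) x *
    frozenProfile L (fun β' => stiffGaussExp L (β' / 2) β') (fun β' => min (1 / 40) (powScale (1 / 2) β' * btLog β')) β x with hΩdef
  set Θ : (Edge 3 L → Fin 3 → ℝ) → ℝ := fun x => Ω (linkEmbed L x) with hΘdef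
  set g : (Edge 3 L → Fin 3 → ℝ) → ℝ := fun x => v (orthoTube L u x) with hgdef
  set w : (Edge 3 L → Fin 3 → ℝ) → ℝ := fun x => softWeight χ (orthoTube L u x) with hwdef
  set wb : (Edge 3 L → Fin 3 → ℝ) → ℝ := fun x => softWeight χ (orthoTube L 1 x) with hwbdef
  set rf : ℝ := min (1 / 40) (powScale (1 / 2) β * btLog β) with hrfdef
  set τ : ℝ := powScale 1 β * btLog β with hτdef
  set S₂ : Set (GaugeConfig 3 L SU2) := {U | τ < ‖(gaugeModes L).starProjection (relLinkVec L U)‖} with hS₂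
  set S₃ : Set (GaugeConfig 3 L SU2) := {U | rf / 2 < ‖relLinkVec L U‖} with hS₃
  set Sx : Set (Edge 3 L → Fin 3 → ℝ) := {x | ‖linkEmbed L x‖ ≤ rf / 2 ∧ ‖(gaugeModes L).starProjection (linkEmbed L x)‖ ≤ τ} with hSx
  set S' : Set (Edge 3 L → Fin 3 → ℝ) := Sx ∩ {x | Θ x ≠ 0} with hS'
  set κ : ℝ := C * (43 * powScale s β) ^ 2 with hκdef
  set Nbar := fpWeightBar L (powScale 1 β) with hNbar
  have hNbar0 : 0 < Nbar := fpWeightBar_pos L (powScale_pos 1 β)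
  have hκ0 : 0 ≤ κ := by positivity
  have hκ1 : κ ≤ 1 / 2 := hCδ
  -- data: measurability and bounds
  have hqfm : ∀ β', Measurable ((fun β'' : ℝ => stiffGaussExp L (β'' / 2) β'') β') := fun β' => measurable_stiffGaussExp _ _
  have hqf0 : ∀ β' x, 0 ≤ (fun β'' : ℝ => stiffGaussExp L (β'' / 2) β'') β' x := fun β' x => stiffGaussExp_nonneg _ _ x
  have hΩGm : Measurable (frozenProfile L (fun β' => stiffGaussExp L (β' / 2) β') (fun β' => min (1 / 40) (powScale (1 / 2) β' * btLog β')) β) :=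
    measurable_frozenProfile hqfm _ β
  have hΩG0 : ∀ x, 0 ≤ frozenProfile L (fun β' => stiffGaussExp L (β' / 2) β') (fun β' => min (1 / 40) (powScale (1 / 2) β' * btLog β')) β x :=
    fun x => (frozenProfile_mem_Icc hqf0 _ β x).1
  have hΩG1 : ∀ x, |frozenProfile L (fun β' => stiffGaussExp L (β' / 2) β') (fun β' => min (1 / 40) (powScale (1 / 2) β' * btLog β')) β x| ≤ 1 :=
    abs_frozenProfile_le hqf0 _ β
  have hΩm : Measurable Ω := measurable_capRestrict (L := L) hΩGm
  have hΩ1 : ∀ x, |Ω x| ≤ 1 := fun x => (capRestrict_mem (L := L) hΩG0 hΩG1 x).2.2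
  have hΘm : Measurable Θ := hΩm.comp (measurable_linkEmbed L)
  have hΘb : ∀ x, |Θ x| ≤ 1 := fun x => hΩ1 _
  obtain ⟨hsm, hsb, hs0, -⟩ := softWeight_recordChi_props (L := L) s 43 M β
  have hgm : Measurable g := hv.comp (measurable_orthoTube_right u)
  have hgb : ∀ x, |g x| ≤ Cv := fun x => hCv _
  have hwm : Measurable w := hsm.comp (measurable_orthoTube_right u)
  have hwbm : Measurable wb := hsm.comp (measurable_orthoTube_right 1)
  have hw0 : ∀ x, 0 ≤ w x := fun x => hs0 _
  have hl : Continuous fun x : Edge 3 L → Fin 3 → ℝ => linkEmbed L x := (linkEmbed L).continuous_of_finiteDimensional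
  have hSxm : MeasurableSet Sx :=
    (measurableSet_le hl.norm.measurable measurable_const).inter (measurableSet_le ((gaugeModes L).starProjection.continuous.comp hl).norm.measurable measurable_const)
  have hS'm : MeasurableSet S' := hSxm.inter (hΘm (measurableSet_singleton (0 : ℝ)).compl)
  -- the orthogonality hypothesis in fibre coordinates
  have horth' : ∫ x, g x * Θ x * w x ∂orthoTransverse L = 0 := by simpa [fibreInner, hgdef, hΘdef, hwdef, hΩdef] using horth
  -- the weight comparison on `S' ∩ {g ≠ 0}`
  have hP' : ∀ U ∈ F, Nbar * (1 - κ) ≤ gaugeAvg χ U ∧ gaugeAvg χ U ≤ Nbar * (1 + κ) := fun U hU => hP β hβ0 U hU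
  have hcmp : ∀ x ∈ S', g x ≠ 0 → |wb x - w x| ≤ 2 * κ / (1 - κ) * w x := by
    intro x hx hgx
    have hΘx : Θ x ≠ 0 := hx.2
    have hxcap : x ∈ capBalancedSet L := (linkEmbed_mem_capLink_iff x).1 (by
      by_contra h; exact hΘx (by simp only [hΘdef, hΩdef, Set.indicator_of_notMem h, zero_mul]))
    have hU : orthoTube L u x ∈ F := by
      have h := hsupp _ hgx
      by_contra hU; exact h (by rw [hχdef, recordChi_eq_indicator_mul, Set.indicator_of_notMem hU, zero_mul])
    have hU₁ : orthoTube L 1 x ∈ F := hgeo x hΘx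
    exact softWeight_orthoTube_compare s 43 M β hκ0 (by linarith) hP' u hxcap hU hU₁
  -- apply the abstract almost-orthogonality inequality
  have key := StiffDoor.sq_integral_core_profile_le' (μ := orthoTransverse L) hgm hgb hΘm hΘb hwm (fun x => hsb _) hw0 hwbm (fun x => hsb _) hS'm hcmp horth'
  -- identify the left side: `v₁(oT u x)·Θ(x) = 𝟙_{S'} g (x)·Θ(x)`
  have hlhs : ∀ x, (S₂ ∪ S₃)ᶜ.indicator v (orthoTube L u x) * Θ x * wb x = S'.indicator g x * Θ x * wb x := fun x => by
    by_cases hΘx : Θ x = 0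
    · simp only [hΘx, mul_zero, zero_mul]
    · have hxcap : x ∈ capBalancedSet L := (linkEmbed_mem_capLink_iff x).1 (by
        by_contra h; exact hΘx (by simp only [hΘdef, hΩdef, Set.indicator_of_notMem h, zero_mul]))
      have hrel : relLinkVec L (orthoTube L u x) = linkEmbed L x := relLinkVec_orthoTube L u hxcap
      by_cases hxS : x ∈ Sx
      · have h1 : orthoTube L u x ∈ (S₂ ∪ S₃)ᶜ := by
          rw [Set.mem_compl_iff, Set.mem_union, not_or]
          simp only [hS₂, hS₃, Set.mem_setOf_eq, hrel, not_lt]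
          exact ⟨hxS.2, hxS.1⟩
        rw [Set.indicator_of_mem h1, Set.indicator_of_mem (show x ∈ S' from ⟨hxS, hΘx⟩)]
      · have h1 : orthoTube L u x ∉ (S₂ ∪ S₃)ᶜ := by
          rw [Set.mem_compl_iff, not_not, Set.mem_union]
          simp only [hS₂, hS₃, Set.mem_setOf_eq, hrel]
          simp only [hSx, Set.mem_setOf_eq, not_and_or, not_le] at hxS
          rcases hxS with h | h
          · exact Or.inr h
          · exact Or.inl h
        rw [Set.indicator_of_notMem h1, Set.indicator_of_notMem (show x ∉ S' from fun h => hxS h.1)]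
  have hlhs' : ∫ x, (S₂ ∪ S₃)ᶜ.indicator v (orthoTube L u x) * Θ x * wb x ∂orthoTransverse L = ∫ x, S'.indicator g x * Θ x * wb x ∂orthoTransverse L :=
    integral_congr_ae (ae_of_all _ hlhs)
  -- identify the tail: `(𝟙_{S'ᶜ}Θ)² = (𝟙_{Sxᶜ}Θ)²`
  have htail_eq : ∀ x, S'ᶜ.indicator Θ x ^ 2 * w x = (Sxᶜ.indicator Θ x) ^ 2 * w x := fun x => by
    by_cases hΘx : Θ x = 0
    · simp only [Set.indicator, hΘx]; split_ifs <;> simp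
    · by_cases hxS : x ∈ Sx
      · rw [Set.indicator_of_notMem (show x ∉ S'ᶜ from fun h => h ⟨hxS, hΘx⟩), Set.indicator_of_notMem (show x ∉ Sxᶜ from fun h => h hxS)]
      · rw [Set.indicator_of_mem (show x ∈ S'ᶜ from fun h => hxS h.1), Set.indicator_of_mem (show x ∈ Sxᶜ from hxS)]
  have htail_eq' : ∫ x, S'ᶜ.indicator Θ x ^ 2 * w x ∂orthoTransverse L = ∫ x, (Sxᶜ.indicator Θ x) ^ 2 * w x ∂orthoTransverse L :=
    integral_congr_ae (ae_of_all _ htail_eq)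
  -- the two masses: `Z_u ≤ (1+κ)γ`, `tail_u ≤ (a/4)γ`
  have hZ : ∫ x, Θ x ^ 2 * w x ∂orthoTransverse L ≤ (1 + κ) * recordGamma L (fun β' => fun x : LinkSpace L => {x : LinkSpace L | linkCurry x ∈ capBalancedSet L}.indicator (fun _ => (1 : ℝ)) x *
      frozenProfile L (fun β'' => stiffGaussExp L (β'' / 2) β'') (fun β'' => min (1 / 40) (powScale (1 / 2) β'' * btLog β'')) β' x) β :=
    fibre_sq_mass_le s M β hκ0 (fun U hU => (hP' U hU).2) u
  have hT := htail u
  set γ := recordGamma L (fun β' => fun x : LinkSpace L => {x : LinkSpace L | linkCurry x ∈ capBalancedSet L}.indicator (fun _ => (1 : ℝ)) x *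
      frozenProfile L (fun β'' => stiffGaussExp L (β'' / 2) β'') (fun β'' => min (1 / 40) (powScale (1 / 2) β'' * btLog β'')) β' x) β with hγdef
  have hγ0 : 0 ≤ γ := by
    rw [hγdef]; unfold recordGamma boGamma
    exact mul_nonneg (fpWeightBar_pos L (powScale_pos 1 β)).le (integral_nonneg fun v => mul_nonneg (sq_nonneg _) (Real.exp_pos _).le)
  set N := ∫ x, g x ^ 2 * w x ∂orthoTransverse L with hNdef
  have hN0 : 0 ≤ N := integral_nonneg fun x => mul_nonneg (sq_nonneg _) (hw0 x)
  -- the comparison constant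
  have hη1 : 2 * κ / (1 - κ) ≤ 4 * κ := by
    rw [div_le_iff₀ (by linarith)]; nlinarith
  have hη2 : (2 * κ / (1 - κ)) ^ 2 ≤ (4 * κ) ^ 2 := pow_le_pow_left₀ (div_nonneg (by positivity) (by linarith)) hη1 2
  rw [hlhs']
  rw [htail_eq'] at key
  calc (∫ x, S'.indicator g x * Θ x * wb x ∂orthoTransverse L) ^ 2
      ≤ 2 * ((2 * κ / (1 - κ)) ^ 2 * (∫ x, Θ x ^ 2 * w x ∂orthoTransverse L) + ∫ x, (Sxᶜ.indicator Θ x) ^ 2 * w x ∂orthoTransverse L) * N := key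
    _ ≤ 2 * ((4 * κ) ^ 2 * ((1 + κ) * γ) + a / 4 * γ) * N := by
        refine mul_le_mul_of_nonneg_right (mul_le_mul_of_nonneg_left (add_le_add ?_ hT) (by norm_num)) hN0
        exact mul_le_mul hη2 hZ (integral_nonneg fun x => mul_nonneg (sq_nonneg _) (hw0 x)) (sq_nonneg _)
    _ ≤ 2 * ((4 * κ) ^ 2 * (2 * γ) + a / 4 * γ) * N := by
        refine mul_le_mul_of_nonneg_right (mul_le_mul_of_nonneg_left (add_le_add (mul_le_mul_of_nonneg_left ?_ (sq_nonneg _)) le_rfl) (by norm_num)) hN0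
        nlinarith
    _ = (2 * ((4 * κ) ^ 2 * 2) + a / 2) * γ * N := by ring
    _ ≤ (a / 2 + a / 2) * γ * N := by
        refine mul_le_mul_of_nonneg_right (mul_le_mul_of_nonneg_right ?_ hγ0) hN0
        linarith [hηβ]
    _ = a * γ * N := by ring

end Summit.QuantumFields.YangMills.Theorems.FemtoTransferGap.TwoLattice.ConstTube

end
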